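import Mathlib
import Literature.NumberTheory.LFunctions.VinogradovZetaSumBilinear
import Summits.ValiantsHypothesis.ValiantsHypothesis.Theorems.LiouvilleSarnakAlignedTypeICharactersMod2nBilinearSievePostnikovLog
import HarnessLib

/-!
# Route LiouvilleSarnak — support `AlignedTypeI` (stmt-ValiantsHypothesis-21040), line `characters_mod_2n`:
# the Postnikov sums ARE Korobov's bilinear Weyl sums `VKZeta.Usum`

Eighth brick for `HS`: the adapter between `…ShortCharSumsShift.norm_charSum_le_postnikovSums` (inner sums
`Σ_{x,y≤a} χ(1 + 2^τ ñ xy)`) and the tree's Korobov bound `VKZeta.norm_Usum_pow_le` (sums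
`U = Σ_{x,y≤a} e(Σ_i α_i (xy)^{i+1})`).  By `postnikov_formula`, for a primitive `χ` mod `2^{n+τ}` (`n ≥ 1`, `τ ≥ 2`) there is
an odd `c` such that for EVERY `ñ ∈ ℕ` and `a`,

  `Σ_{x,y ∈ [1,a]} χ(1 + 2^τ ñ xy) = VKZeta.Usum a (α ñ)`,
  `α ñ i = c (−1)^i ((n+τ)!/(i+1)) 2^{τ(i+1)} ñ^{i+1} / 2^{n+τ+s}`  (`s = v₂((n+τ)!)`)

(`postnikovSum_eq_Usum`).  The coefficient `α ñ i` is a rational with EXACT `2`-power denominator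
`2^{n+τ−τ(i+1)+v₂(i+1)}` when `ñ` is odd (`c` odd; `…PostnikovLog.two_pow_dvd_logTerm` gives the valuation of the
numerator), which is what the good-factor count of Ivić's Lemma 6.5 (`MoebiusWalsh.sum_Ico_geomBound_mul_div_le`) needs.

HONEST FRAMING. Helper theorem (unconditional); the leaf `AlignedTypeI` is NOT closed here; nothing bears on `VP ≠ VNP`
(NOT proved).
-/

set_option linter.dupNamespace false

noncomputable section

namespace Summit.ValiantsHypothesis.ValiantsHypothesis.Theorems.LiouvilleSarnak.AlignedTypeI.CharactersModTwoN

open Finset Complex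
open Literature.NumberTheory.LFunctions

/-- Sums over `[1, a] ⊂ ℤ` are sums over `[1, a] ⊂ ℕ`. [folklore] -/
theorem sum_Icc_int_eq_sum_Icc_nat {M : Type*} [AddCommMonoid M] (f : ℤ → M) (a : ℕ) :
    ∑ x ∈ Finset.Icc (1 : ℤ) a, f x = ∑ x ∈ Finset.Icc 1 a, f (x : ℤ) := by
  have himage : (Finset.Icc 1 a).image (fun x : ℕ => (x : ℤ)) = Finset.Icc (1 : ℤ) a := by
    ext z
    simp only [mem_image, mem_Icc]
    constructor
    · rintro ⟨x, ⟨h1, h2⟩, rfl⟩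
      exact ⟨by exact_mod_cast h1, by exact_mod_cast h2⟩
    · rintro ⟨h1, h2⟩
      refine ⟨z.toNat, ⟨by omega, by omega⟩, by omega⟩
  rw [← himage, sum_image fun x _ y _ h => by exact_mod_cast h]

/-- ★ **Postnikov sums = Korobov's `Usum`.**  For a primitive `χ` mod `2^{n+τ}` (`n ≥ 1`, `τ ≥ 2`) there is an odd `c`
such that `Σ_{x,y∈[1,a]} χ(1 + 2^τ ñ xy) = VKZeta.Usum a (α ñ)` for all `ñ, a`, with the explicit phase coefficients
`α ñ i = c (−1)^i ((n+τ)!/(i+1)) 2^{τ(i+1)} ñ^{i+1} / 2^{n+τ+v₂((n+τ)!)}`. [folklore] -/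
theorem postnikovSum_eq_Usum {τ : ℕ} (hτ : 2 ≤ τ) {n : ℕ} (hn : 1 ≤ n) (χ : DirichletCharacter ℂ (2 ^ (n + τ)))
    (hχ : χ.IsPrimitive) :
    ∃ c : ℕ, Odd c ∧ ∀ (nt a : ℕ),
      ∑ x ∈ Finset.Icc 1 a, ∑ y ∈ Finset.Icc 1 a,
        χ (1 + (2 : ZMod (2 ^ (n + τ))) ^ τ * ((nt : ZMod (2 ^ (n + τ))) * ((x * y : ℕ) : ZMod (2 ^ (n + τ))))) =
      VKZeta.Usum a (fun i : Fin (n + τ) =>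
        (c : ℝ) * (-1) ^ (i.val) * (((n + τ).factorial / (i.val + 1) : ℕ) : ℝ) * (2 : ℝ) ^ (τ * (i.val + 1)) *
          (nt : ℝ) ^ (i.val + 1) / (2 : ℝ) ^ (n + τ + padicValNat 2 (n + τ).factorial)) := by
  obtain ⟨c, hcodd, hc⟩ := postnikov_formula hτ hn χ hχ
  refine ⟨c, hcodd, fun nt a => ?_⟩
  unfold VKZeta.Usum
  rw [sum_Icc_int_eq_sum_Icc_nat]
  refine sum_congr rfl fun x _ => ?_
  rw [sum_Icc_int_eq_sum_Icc_nat]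
  refine sum_congr rfl fun y _ => ?_
  -- left: Postnikov's formula at `v = ñ x y`
  have hcast : (1 + (2 : ZMod (2 ^ (n + τ))) ^ τ * ((nt : ZMod (2 ^ (n + τ))) * ((x * y : ℕ) : ZMod (2 ^ (n + τ))))) =
      ((1 + 2 ^ τ * (nt * (x * y)) : ℕ) : ZMod (2 ^ (n + τ))) := by push_cast; ring
  rw [hcast, hc (nt * (x * y)), VMV.E_eq_e_sum, VdC.e]
  congr 1
  -- compare the two phases
  set L : ℤ := ∑ m ∈ Finset.range (n + τ), (-1 : ℤ) ^ m * (((n + τ).factorial / (m + 1) : ℕ) : ℤ) *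
      ((2 : ℤ) ^ τ * ((nt * (x * y) : ℕ) : ℤ)) ^ (m + 1) with hL
  have hsumR : (L : ℝ) = ∑ i : Fin (n + τ), (-1 : ℝ) ^ (i.val) * (((n + τ).factorial / (i.val + 1) : ℕ) : ℝ) *
        ((2 : ℝ) ^ τ * (nt * (x * y) : ℝ)) ^ (i.val + 1) := by
    rw [hL]
    push_cast
    rw [← Finset.sum_range fun i => (-1 : ℝ) ^ i * (((n + τ).factorial / (i + 1) : ℕ) : ℝ) *
      ((2 : ℝ) ^ τ * (nt * (x * y) : ℝ)) ^ (i + 1)]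
    rfl
  have hT : (∑ j : Fin (n + τ), ((VMV.nu (n + τ) ((x : ℤ) * (y : ℤ)) j : ℝ)) *
      ((c : ℝ) * (-1) ^ (j.val) * (((n + τ).factorial / (j.val + 1) : ℕ) : ℝ) * (2 : ℝ) ^ (τ * (j.val + 1)) *
        (nt : ℝ) ^ (j.val + 1) / (2 : ℝ) ^ (n + τ + padicValNat 2 (n + τ).factorial))) =
      (c : ℝ) * (L : ℝ) / (2 : ℝ) ^ (n + τ + padicValNat 2 (n + τ).factorial) := by
    rw [hsumR, Finset.mul_sum, Finset.sum_div]
    refine Finset.sum_congr rfl fun j _ => ?_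
    simp only [VMV.nu]
    push_cast
    rw [pow_mul]
    ring
  rw [hT]
  push_cast
  ring

end Summit.ValiantsHypothesis.ValiantsHypothesis.Theorems.LiouvilleSarnak.AlignedTypeI.CharactersModTwoN
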